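import Summits.QuantumFields.BalabanUV.Beta.GAN24.CombKernelSheetResponse
import Summits.QuantumFields.BalabanUV.Beta.GAN24.TransverseDictionary
import Summits.QuantumFields.BalabanUV.Beta.KernelWardResponse
import Summits.QuantumFields.BalabanUV.Beta.CoDressedMmRead
import Summits.QuantumFields.BalabanUV.Beta.GAN24.MultiplierZeroMass

/-!
# `BalabanUV.Beta.GAN24.CombKernelFaceResponse` — binder row G-an2-4 ∕ (CONV-C), W-slot CT-W, the letter (FF) of the «3F-REC» induction, PART B of
# `CombKernelSheetResponse`: **FACES ↦ FACES — the comb kernel maps the period-`P` coarse EXIT-FACE background to the period-`Lc·P` fine EXIT-FACE form,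
# columns AND rows, every `P`, same coefficient `cH_j`**

NOT IN PRINT; OUR BOOKKEEPING ([folklore]; G-an2-4 formalisation swarm, leaf prover `b2b-balaban-gan24-formalise-leaf-04`, gen 62; INTENT I-leaf04-g62-2; names PROVISIONAL).
HONEST FRAMING (cell contract, verbatim): «discharging `BetaPertH` makes Bałaban's UV stability UNCONDITIONAL — a real constructive-QFT result; it is NOT the continuum
limit and NOT the Clay problem.»  HONEST DEPENDENCY (verbatim): «continuum YM on T⁴ ⇐ BetaPertH ∧ nine spine estimates (0/9 proved); BetaPertH ⇐ (D1) ∧ (D4) ∧ CAP+tail;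
G-an2-4 gates asym, D1 and NE2/3/4.»

WHAT ([folklore]; 0 `def`, 0 cited facts, 0 `def … : Prop`, 0 sorry; generic `d`, every `j`, every in-block root, every `P : ℕ`):
* `tsum_weight_sheet` — a bounded weight of the sheet index against a summable family on `ℤ^{d+1}` is the sheet-index sum of the weighted sheet sums.
* **`hasSum_colH_face`**: `HasSum (y ↦ [y_α % P = P−1]·colH G_j Lc α y κ u) (cH_j·[κ = α]·[u_α % Lc = Lc−1]·[(u_α ∕ Lc) % P = P−1])` — PART A's sheet law summed over the
  sheets `m ≡ −1 (P)`; `P = 1` is leaf-02 g51 ∕ p2 g35's uniform-background charge (`tsum_source_colH_coDressKBm_KInvStep` ∕ `hasSum_coDressKBmAt_col`, `cH_j = Lc·σ_j`).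
* **`hasSum_row_face`**: the `(inr α, inl a)`-row twin, value NEGATED (PART A §1).
* §6 (the ZERO-MULTIPLIER clause): `comb_inr_inr_symm` (the `mm` block of the comb kernel is symmetric — `coDressKBmAt_inr_inr`, `KInvStep_inr_inr`,
  `TransverseDictionary.KInv_inr_inr_symm`), `summable_mm_col`, **`tsum_mm_col_sheet`** (EVERY SHEET SUM OF THE `mm` BLOCK VANISHES — the multiplier-row
  Ward law `KernelWardResponse.rowM_ward_coDressKBmAt_KInvStep` summed over a coarse hyperplane: consecutive sheet sums are equal, summable over the sheet
  index, hence zero; an4's `MultiplierZeroMass` is the total), **`hasSum_mm_col_face`** ∕ **`hasSum_mm_row_face`** (face sums of the `mm` block vanish in both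
  index positions, every `P`).
These are the site-dependent charges `ρ̃L ∕ ρ̃R` that p2 g35's `hasSum_sandwich_readout_dep` takes when the coarse legs of the sandwich are summed against exit faces of
period `P` instead of plainly — the unrolling step «3F_j^{(P)} = const_j · 3F_{j−1}^{(Lc·P)}» of the «3F-REC» induction (next file).  ENGINE (DIAG-ONLY; R-leaf04-g62-4): exact to
1e-15 at D = 2.  Discharges NOTHING of «3F-REC» ∕ «S3C-REC» ∕ F2a-comb ∕ (C)sym ∕ (Q-D) ∕ (Q-D-rate) ∕ «T2Shape» ∕ «T2Drift» ∕ (hW, hWall); NOT «D1 closed»; NEVER «G-an2-4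
closed» as (CONV-C); NOT D1, NOT `BetaPertH`, NOT continuum, NOT Clay.  2026-08-22; no existing file touched.
-/

noncomputable section

open Finset Filter
open scoped BigOperators Topology
open Literature.MathematicalPhysics.QuantumFieldTheory
open Literature.MathematicalPhysics.QuantumFieldTheory.Balaban1983to89
open Literature.MathematicalPhysics.QuantumFieldTheory.Balaban1983to89.Beta
open B12Sec2to5 (l1 l1_nonneg)
open B6BondElimination (unitVec unitVec_apply)
open ExpKernelCalculus (Site MKer Decays)
open AffineAveraging (box toSite)
open AveragingContours (blk)
open OneStepResolventKernel (Fib)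
open OneStepKernelFamily (KInvStep colH abs_colH_le)
open Summit.QuantumFields.BalabanUV.Beta.AxialDressingRooted (coDressKBmAt decays_coDressKBmAt_KInvStep pmBm cube coProjBmW coProjBmW_apply colH_coDressKBmAt_eq
  coDressKBmAt_inr_inr)
open Summit.QuantumFields.BalabanUV.Beta.BorderedHessian (stepScale)
open Summit.QuantumFields.BalabanUV.Beta.KernelWardRelative (gaugeWt)
open Summit.QuantumFields.BalabanUV.Beta.KernelWardHColumnWall (colH_ward_KInvStep_all)
open Summit.QuantumFields.BalabanUV.Beta.GAN24.CoDressedColumnSourceSums (rowH_coDressKBmAt)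
open Summit.QuantumFields.BalabanUV.Beta.GAN24.LinT2ZeroModeStep (KInvStep_inr_inl_eq_neg)
open Summit.QuantumFields.BalabanUV.Beta.GAN24.ResolventLegCharges (summable_exp_coarse')

open Summit.QuantumFields.BalabanUV.Beta.GAN24.TransverseDictionary (KInv_inr_inr_symm)
open Summit.QuantumFields.BalabanUV.Beta.KernelWardResponse (rowM_ward_coDressKBmAt_KInvStep)
open Summit.QuantumFields.BalabanUV.Beta.GAN24.MultiplierZeroMass (KInvStep_inr_inr)

namespace Summit.QuantumFields.BalabanUV.Beta.GAN24.CombKernelFaceResponse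

open Summit.QuantumFields.BalabanUV.Beta.GAN24.CombKernelSheetResponse (coDressKBmAt_KInvStep_inr_inl_eq_neg_colH summable_colH_comb
  insertNthEquiv_apply_same tsum_sheet_eq_fibre tsum_colH_sheet add_unitVec_apply summable_tsum_sheet eq_zero_of_summable_const)

variable {d : ℕ} {Lc : ℕ} [NeZero Lc]

/-! ## §5 Faces ↦ faces: the period-`P` exit-face background -/

section Face

variable {r : Fin (d + 1) → ℕ}

omit [NeZero Lc] in
/-- [folklore] a weight in the sheet index against a sheet-decomposed family: `Σ'_y w(y_α)·f y = Σ'_m w(m)·Σ'_{y : y_α = m} f y` for bounded `w`. -/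
theorem tsum_weight_sheet {f : Site (d + 1) → ℝ} (hf : Summable f) (α : Fin (d + 1)) {w : ℤ → ℝ} {B : ℝ} (hw : ∀ m, |w m| ≤ B) :
    ∑' y : Site (d + 1), w (y α) * f y = ∑' m : ℤ, w m * ∑' y : Site (d + 1), (if y α = m then f y else 0) := by
  set E := Fin.insertNthEquiv (fun _ : Fin (d + 1) => ℤ) α with hE
  have hB : 0 ≤ B := (abs_nonneg _).trans (hw 0)
  have hg : Summable (f ∘ ⇑E) := E.summable_iff.2 hf
  have hwg : Summable fun p : ℤ × (Fin d → ℤ) => w p.1 * (f ∘ ⇑E) p := by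
    refine Summable.of_norm_bounded (hg.norm.mul_left B) fun p => ?_
    rw [Real.norm_eq_abs, abs_mul, Real.norm_eq_abs]
    exact mul_le_mul_of_nonneg_right (hw p.1) (abs_nonneg _)
  rw [← E.tsum_eq (fun y : Site (d + 1) => w (y α) * f y)]
  have e1 : (fun p : ℤ × (Fin d → ℤ) => w ((E p) α) * f (E p)) = fun p => w p.1 * (f ∘ ⇑E) p := by
    funext p
    rw [insertNthEquiv_apply_same]
    rfl
  rw [e1, hwg.tsum_prod' (fun m' => (hg.prod_factor m').mul_left (w m'))]
  refine tsum_congr fun m' => ?_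
  show (∑' c : Fin d → ℤ, w m' * (f ∘ ⇑E) (m', c)) = _
  rw [tsum_mul_left, tsum_sheet_eq_fibre hf α m']
  rfl

/-- NOT IN PRINT; OUR BOOKKEEPING.  **FACES ↦ FACES (columns)**: the `ℋ`-column response of the comb kernel at the fine bond `(κ, u)` to the PERIOD-`P` EXIT-FACE
BACKGROUND on the coarse lattice (direction-`α` bonds with `y_α % P = P−1`, any `P ≥ 1`) is `cH_j · [κ = α] · [u_α % Lc = Lc−1] · [(u_α ∕ Lc) % P = P−1]` — the
exit-face indicator of period `Lc·P` on the fine lattice with the SAME coefficient `cH_j` for every `P` (`P = 1`: leaf-02 g51 ∕ p2 g35's uniform-background charge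
`tsum_source_colH_coDressKBm_KInvStep` ∕ `hasSum_coDressKBmAt_col`, `cH_j = Lc·σ_j`). -/
theorem hasSum_colH_face (hr : r ∈ box (d + 1) Lc) (j : ℕ) (α κ : Fin (d + 1)) (u : Site (d + 1)) (P : ℕ) :
    HasSum (fun y : Site (d + 1) =>
        if y α % (P : ℤ) = (P : ℤ) - 1 then colH (coDressKBmAt (toSite r) Lc (KInvStep (d := d) Lc j)) Lc α y κ u else 0)
      ((stepScale d Lc j * (Lc : ℝ) ^ (d + 1))⁻¹ *
          ((if κ = α then (1 : ℝ) else 0) * (if u α % (Lc : ℤ) = (Lc : ℤ) - 1 then (1 : ℝ) else 0) *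
            (if (u α / (Lc : ℤ)) % (P : ℤ) = (P : ℤ) - 1 then (1 : ℝ) else 0))) := by
  have hf := summable_colH_comb hr j α κ u
  -- summability of the face-restricted family
  have hF : Summable fun y : Site (d + 1) =>
      if y α % (P : ℤ) = (P : ℤ) - 1 then colH (coDressKBmAt (toSite r) Lc (KInvStep (d := d) Lc j)) Lc α y κ u else 0 := by
    refine Summable.of_norm_bounded hf.norm fun y => ?_
    split_ifs
    · exact le_rfl
    · rw [norm_zero]; exact norm_nonneg _
  -- rewrite the face indicator as a weight of the sheet index and decompose
  have e1 : (fun y : Site (d + 1) =>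
        if y α % (P : ℤ) = (P : ℤ) - 1 then colH (coDressKBmAt (toSite r) Lc (KInvStep (d := d) Lc j)) Lc α y κ u else 0)
      = fun y => (fun m : ℤ => if m % (P : ℤ) = (P : ℤ) - 1 then (1 : ℝ) else 0) (y α) *
          colH (coDressKBmAt (toSite r) Lc (KInvStep (d := d) Lc j)) Lc α y κ u := by
    funext y
    show _ = (if y α % (P : ℤ) = (P : ℤ) - 1 then (1 : ℝ) else 0) * _
    split_ifs <;> simp
  have hw : ∀ m : ℤ, |(fun m : ℤ => if m % (P : ℤ) = (P : ℤ) - 1 then (1 : ℝ) else 0) m| ≤ 1 := by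
    intro m
    show |(if m % (P : ℤ) = (P : ℤ) - 1 then (1 : ℝ) else 0)| ≤ 1
    split_ifs <;> simp
  have hval : ∑' y : Site (d + 1),
        (if y α % (P : ℤ) = (P : ℤ) - 1 then colH (coDressKBmAt (toSite r) Lc (KInvStep (d := d) Lc j)) Lc α y κ u else 0)
      = (stepScale d Lc j * (Lc : ℝ) ^ (d + 1))⁻¹ *
          ((if κ = α then (1 : ℝ) else 0) * (if u α % (Lc : ℤ) = (Lc : ℤ) - 1 then (1 : ℝ) else 0) *
            (if (u α / (Lc : ℤ)) % (P : ℤ) = (P : ℤ) - 1 then (1 : ℝ) else 0)) := by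
    rw [e1, tsum_weight_sheet hf α hw]
    simp only [tsum_colH_sheet hr j α κ u]
    have e2 : (fun m : ℤ => (if m % (P : ℤ) = (P : ℤ) - 1 then (1 : ℝ) else 0) *
        ((stepScale d Lc j * (Lc : ℝ) ^ (d + 1))⁻¹ *
          ((if κ = α then (1 : ℝ) else 0) * (if u α % (Lc : ℤ) = (Lc : ℤ) - 1 then (1 : ℝ) else 0) * (if u α / (Lc : ℤ) = m then (1 : ℝ) else 0))))
        = fun m => if m = u α / (Lc : ℤ) then
            (stepScale d Lc j * (Lc : ℝ) ^ (d + 1))⁻¹ *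
              ((if κ = α then (1 : ℝ) else 0) * (if u α % (Lc : ℤ) = (Lc : ℤ) - 1 then (1 : ℝ) else 0) *
                (if (u α / (Lc : ℤ)) % (P : ℤ) = (P : ℤ) - 1 then (1 : ℝ) else 0)) else 0 := by
      funext m
      by_cases h : m = u α / (Lc : ℤ)
      · subst h
        simp only [if_true]
        ring
      · have h' : ¬ (u α / (Lc : ℤ) = m) := fun e => h e.symm
        simp only [h, h', if_false, mul_zero]
    rw [e2, tsum_ite_eq]
  rw [← hval]
  exact hF.hasSum

/-- NOT IN PRINT; OUR BOOKKEEPING.  **FACES ↦ FACES (rows)**: the `(inr α, inl a)`-ROW response of the comb kernel at the fine bond `(a, y)` to the period-`P`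
exit-face background, `HasSum (x″ ↦ [x″_α % P = P−1]·G_j (Lc•x″) y (inr α) (inl a)) (−cH_j·[a = α]·[y_α % Lc = Lc−1]·[(y_α ∕ Lc) % P = P−1])` — §1 (rows are minus
columns) on `hasSum_colH_face`. -/
theorem hasSum_row_face (hr : r ∈ box (d + 1) Lc) (j : ℕ) (α a : Fin (d + 1)) (y : Site (d + 1)) (P : ℕ) :
    HasSum (fun x'' : Site (d + 1) =>
        if x'' α % (P : ℤ) = (P : ℤ) - 1 then coDressKBmAt (toSite r) Lc (KInvStep (d := d) Lc j) ((Lc : ℤ) • x'') y (Sum.inr α) (Sum.inl a) else 0)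
      (-((stepScale d Lc j * (Lc : ℝ) ^ (d + 1))⁻¹ *
          ((if a = α then (1 : ℝ) else 0) * (if y α % (Lc : ℤ) = (Lc : ℤ) - 1 then (1 : ℝ) else 0) *
            (if (y α / (Lc : ℤ)) % (P : ℤ) = (P : ℤ) - 1 then (1 : ℝ) else 0)))) := by
  refine (hasSum_colH_face hr j α a y P).neg.congr_fun fun x'' => ?_
  rw [coDressKBmAt_KInvStep_inr_inl_eq_neg_colH]
  split_ifs <;> simp

end Face


/-! ## §6 The multiplier–multiplier block: sheet and face sums VANISH (the zero-multiplier clause of «faces ↦ faces») -/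

section Mult

variable {r : Fin (d + 1) → ℕ}

omit [NeZero Lc] in
/-- [folklore] **THE mm BLOCK OF THE COMB KERNEL IS SYMMETRIC** (`coDressKBmAt_inr_inr`: the dressing does not touch it; an4's `KInvStep_inr_inr` + the
packed resolvent's `KInv_inr_inr_symm`). -/
theorem comb_inr_inr_symm [NeZero Lc] (ρ : Fin (d + 1) → ℤ) (j : ℕ) (x z : Site (d + 1)) (a b : Fin (d + 1)) :
    coDressKBmAt ρ Lc (KInvStep (d := d) Lc j) x z (Sum.inr a) (Sum.inr b)
      = coDressKBmAt ρ Lc (KInvStep (d := d) Lc j) z x (Sum.inr b) (Sum.inr a) := by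
  rw [coDressKBmAt_inr_inr, coDressKBmAt_inr_inr, KInvStep_inr_inr, KInvStep_inr_inr, KInv_inr_inr_symm]

/-- [folklore] The `mm` column family of the comb kernel at a fixed first index is summable over the coarse second index. -/
theorem summable_mm_col (hr : r ∈ box (d + 1) Lc) (j : ℕ) (x₂ : Site (d + 1)) (ρ' μ : Fin (d + 1)) :
    Summable fun y : Site (d + 1) => coDressKBmAt (toSite r) Lc (KInvStep (d := d) Lc j) x₂ ((Lc : ℤ) • y) (Sum.inr ρ') (Sum.inr μ) := by
  obtain ⟨δ, C, hδ, hC, hG⟩ := decays_coDressKBmAt_KInvStep (d := d) hr j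
  refine Summable.of_norm_bounded ((summable_exp_coarse' (d := d) (N := Lc) NeZero.one_le hδ x₂).mul_left C) fun y => ?_
  rw [Real.norm_eq_abs]
  exact hG x₂ ((Lc : ℤ) • y) (Sum.inr ρ') (Sum.inr μ)

/-- NOT IN PRINT; OUR BOOKKEEPING.  **THE mm SHEET SUMS VANISH** (column position): for every fine `x₂`, fibre `ρ′`, sheet direction `α` and sheet `m`,
`Σ'_{y : y_α = m} G_j x₂ (Lc•y) (inr ρ′) (inr α) = 0` — the multiplier-row Ward law `KernelWardResponse.rowM_ward_coDressKBmAt_KInvStep` ((hM♯): zero response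
of the multiplier rows to every coarse pure gauge `dδ_Y`) summed over the hyperplane `{Y_α = m+1}` says consecutive sheet sums are EQUAL; they are summable over
`m ∈ ℤ`, hence zero.  (The full coarse sum `Σ'_y` is an4's zero mass `MultiplierZeroMass.hasSum_KInvStep_mm_right`; here EVERY sheet vanishes separately —
the zero-multiplier clause of the closed-background response, engine R-leaf04-g62-3 ∕ -4.) -/
theorem tsum_mm_col_sheet (hr : r ∈ box (d + 1) Lc) (j : ℕ) (x₂ : Site (d + 1)) (ρ' α : Fin (d + 1)) (m : ℤ) :
    ∑' y : Site (d + 1), (if y α = m then coDressKBmAt (toSite r) Lc (KInvStep (d := d) Lc j) x₂ ((Lc : ℤ) • y) (Sum.inr ρ') (Sum.inr α) else 0) = 0 := by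
  set G := coDressKBmAt (toSite r) Lc (KInvStep (d := d) Lc j) with hG
  set R : ℤ → ℝ := fun m => ∑' y : Site (d + 1), (if y α = m then G x₂ ((Lc : ℤ) • y) (Sum.inr ρ') (Sum.inr α) else 0) with hRdef
  -- summability of every sheet family, every fibre direction, shifted or not
  have hsum : ∀ μ : Fin (d + 1), Summable fun y : Site (d + 1) => G x₂ ((Lc : ℤ) • y) (Sum.inr ρ') (Sum.inr μ) :=
    fun μ => summable_mm_col hr j x₂ ρ' μ
  have hs : ∀ (μ : Fin (d + 1)) (m' : ℤ), Summable fun y : Site (d + 1) =>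
      if y α = m' then G x₂ ((Lc : ℤ) • y) (Sum.inr ρ') (Sum.inr μ) else 0 := by
    intro μ m'
    refine Summable.of_norm_bounded (hsum μ).norm fun y => ?_
    split_ifs
    · exact le_rfl
    · rw [norm_zero]; exact norm_nonneg _
  have hss : ∀ (μ : Fin (d + 1)) (m' : ℤ), Summable fun y : Site (d + 1) =>
      if y α = m' then G x₂ ((Lc : ℤ) • (y - unitVec μ)) (Sum.inr ρ') (Sum.inr μ) else 0 := by
    intro μ m'
    have h0 : Summable fun y : Site (d + 1) => G x₂ ((Lc : ℤ) • (y - unitVec μ)) (Sum.inr ρ') (Sum.inr μ) :=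
      (Equiv.subRight (unitVec μ)).summable_iff.2 (hsum μ)
    refine Summable.of_norm_bounded h0.norm fun y => ?_
    split_ifs
    · exact le_rfl
    · rw [norm_zero]; exact norm_nonneg _
  have hshift : ∀ (μ : Fin (d + 1)) (m' : ℤ),
      (∑' y : Site (d + 1), (if y α = m' + 1 then G x₂ ((Lc : ℤ) • (y - unitVec μ)) (Sum.inr ρ') (Sum.inr μ) else 0))
        = ∑' y : Site (d + 1), (if y α + (if α = μ then 1 else 0) = m' + 1 then G x₂ ((Lc : ℤ) • y) (Sum.inr ρ') (Sum.inr μ) else 0) := by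
    intro μ m'
    rw [← (Equiv.addRight (unitVec μ)).tsum_eq (fun y : Site (d + 1) =>
      if y α = m' + 1 then G x₂ ((Lc : ℤ) • (y - unitVec μ)) (Sum.inr ρ') (Sum.inr μ) else 0)]
    refine tsum_congr fun y => ?_
    simp only [Equiv.coe_addRight, add_sub_cancel_right, add_unitVec_apply]
  -- the multiplier-row Ward law summed over the hyperplane `{y_α = m+1}`: `R m − R (m+1) = 0`
  have hdiff : ∀ m : ℤ, R m - R (m + 1) = 0 := by
    intro m
    have hW : ∀ y : Site (d + 1), ∑ μ, (G x₂ ((Lc : ℤ) • (y - unitVec μ)) (Sum.inr ρ') (Sum.inr μ) - G x₂ ((Lc : ℤ) • y) (Sum.inr ρ') (Sum.inr μ)) = 0 :=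
      fun y => rowM_ward_coDressKBmAt_KInvStep (d := d) (toSite r) j y x₂ ρ'
    have hL : (∑' y : Site (d + 1), (if y α = m + 1 then
        ∑ μ, (G x₂ ((Lc : ℤ) • (y - unitVec μ)) (Sum.inr ρ') (Sum.inr μ) - G x₂ ((Lc : ℤ) • y) (Sum.inr ρ') (Sum.inr μ)) else 0))
        = R m - R (m + 1) := by
      have e1 : (fun y : Site (d + 1) => (if y α = m + 1 then
          ∑ μ, (G x₂ ((Lc : ℤ) • (y - unitVec μ)) (Sum.inr ρ') (Sum.inr μ) - G x₂ ((Lc : ℤ) • y) (Sum.inr ρ') (Sum.inr μ)) else 0))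
          = fun y => ∑ μ, ((if y α = m + 1 then G x₂ ((Lc : ℤ) • (y - unitVec μ)) (Sum.inr ρ') (Sum.inr μ) else 0)
              - (if y α = m + 1 then G x₂ ((Lc : ℤ) • y) (Sum.inr ρ') (Sum.inr μ) else 0)) := by
        funext y
        split_ifs
        · rfl
        · simp
      rw [e1, Summable.tsum_finsetSum (fun μ _ => (hss μ (m + 1)).sub (hs μ (m + 1)))]
      rw [Finset.sum_eq_single α]
      · rw [(hss α (m + 1)).tsum_sub (hs α (m + 1)), hshift α m]
        simp only [if_true, hRdef]
        congr 1
        refine tsum_congr fun y => ?_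
        simp only [add_left_inj]
      · intro μ _ hμ
        rw [(hss μ (m + 1)).tsum_sub (hs μ (m + 1)), hshift μ m]
        simp only [Ne.symm hμ, if_false, add_zero, sub_self]
      · intro h; exact absurd (Finset.mem_univ α) h
    have hWs : (fun y : Site (d + 1) => (if y α = m + 1 then
        ∑ μ, (G x₂ ((Lc : ℤ) • (y - unitVec μ)) (Sum.inr ρ') (Sum.inr μ) - G x₂ ((Lc : ℤ) • y) (Sum.inr ρ') (Sum.inr μ)) else 0))
        = fun _ => 0 := by
      funext y; rw [hW y]; simp
    rw [← hL, hWs, tsum_zero]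
  -- constant and summable over `m`, hence zero
  have hconst : ∀ m : ℤ, R m = R 0 := by
    intro m
    induction m using Int.induction_on with
    | zero => rfl
    | succ k ih => have h := hdiff (k : ℤ); rw [← ih]; linarith
    | pred k ih =>
      have h := hdiff (-(k : ℤ) - 1)
      rw [show (-(k : ℤ) - 1 + 1) = -(k : ℤ) by ring] at h
      rw [← ih]; linarith
  have hRs : Summable R := summable_tsum_sheet (hsum α) α
  have hc : R 0 = 0 := eq_zero_of_summable_const (hRs.congr fun m => hconst m)
  have hm := hconst m
  rw [hc] at hm
  simpa only [hRdef] using hm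

/-- NOT IN PRINT; OUR BOOKKEEPING.  **THE mm FACE SUMS VANISH (column position)**, every period `P`:
`HasSum (y ↦ [y_α % P = P−1]·G_j x₂ (Lc•y) (inr ρ′) (inr α)) 0`. -/
theorem hasSum_mm_col_face (hr : r ∈ box (d + 1) Lc) (j : ℕ) (x₂ : Site (d + 1)) (ρ' α : Fin (d + 1)) (P : ℕ) :
    HasSum (fun y : Site (d + 1) =>
      if y α % (P : ℤ) = (P : ℤ) - 1 then coDressKBmAt (toSite r) Lc (KInvStep (d := d) Lc j) x₂ ((Lc : ℤ) • y) (Sum.inr ρ') (Sum.inr α) else 0) 0 := by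
  have hf := summable_mm_col hr j x₂ ρ' α
  have hF : Summable fun y : Site (d + 1) =>
      if y α % (P : ℤ) = (P : ℤ) - 1 then coDressKBmAt (toSite r) Lc (KInvStep (d := d) Lc j) x₂ ((Lc : ℤ) • y) (Sum.inr ρ') (Sum.inr α) else 0 := by
    refine Summable.of_norm_bounded hf.norm fun y => ?_
    split_ifs
    · exact le_rfl
    · rw [norm_zero]; exact norm_nonneg _
  have e1 : (fun y : Site (d + 1) =>
        if y α % (P : ℤ) = (P : ℤ) - 1 then coDressKBmAt (toSite r) Lc (KInvStep (d := d) Lc j) x₂ ((Lc : ℤ) • y) (Sum.inr ρ') (Sum.inr α) else 0)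
      = fun y => (fun m : ℤ => if m % (P : ℤ) = (P : ℤ) - 1 then (1 : ℝ) else 0) (y α) *
          coDressKBmAt (toSite r) Lc (KInvStep (d := d) Lc j) x₂ ((Lc : ℤ) • y) (Sum.inr ρ') (Sum.inr α) := by
    funext y
    show _ = (if y α % (P : ℤ) = (P : ℤ) - 1 then (1 : ℝ) else 0) * _
    split_ifs <;> simp
  have hw : ∀ m : ℤ, |(fun m : ℤ => if m % (P : ℤ) = (P : ℤ) - 1 then (1 : ℝ) else 0) m| ≤ 1 := by
    intro m
    show |(if m % (P : ℤ) = (P : ℤ) - 1 then (1 : ℝ) else 0)| ≤ 1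
    split_ifs <;> simp
  have hval : ∑' y : Site (d + 1),
      (if y α % (P : ℤ) = (P : ℤ) - 1 then coDressKBmAt (toSite r) Lc (KInvStep (d := d) Lc j) x₂ ((Lc : ℤ) • y) (Sum.inr ρ') (Sum.inr α) else 0) = 0 := by
    rw [e1, tsum_weight_sheet hf α hw]
    simp only [tsum_mm_col_sheet hr j x₂ ρ' α, mul_zero, tsum_zero]
  have h := hF.hasSum
  rwa [hval] at h

/-- NOT IN PRINT; OUR BOOKKEEPING.  **THE mm FACE SUMS VANISH (row position)**, every period `P`:
`HasSum (x″ ↦ [x″_α % P = P−1]·G_j (Lc•x″) z (inr α) (inr μ)) 0` (mm symmetry on the column law). -/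
theorem hasSum_mm_row_face (hr : r ∈ box (d + 1) Lc) (j : ℕ) (z : Site (d + 1)) (α μ : Fin (d + 1)) (P : ℕ) :
    HasSum (fun x'' : Site (d + 1) =>
      if x'' α % (P : ℤ) = (P : ℤ) - 1 then coDressKBmAt (toSite r) Lc (KInvStep (d := d) Lc j) ((Lc : ℤ) • x'') z (Sum.inr α) (Sum.inr μ) else 0) 0 := by
  refine (hasSum_mm_col_face hr j z μ α P).congr_fun fun x'' => ?_
  rw [comb_inr_inr_symm]

end Mult

end Summit.QuantumFields.BalabanUV.Beta.GAN24.CombKernelFaceResponse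

end
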